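/- Copyright: the b2b-balaban cell (near-miss cell 7), T⁴-continuum fan-out; row NE7b CRUX team (2), seat
t4-ne7b-formalise-leaf-03 (gen 28) — custodian's D-50-2′ «THE WEIGHTED PLUG CHAIN», part 5 = THE D-50-2 DELIVERABLE
(R-OWNER-51-1 (5), W-ne7bp1-g51-2∕-5, INTERFACE REQUEST NE7b IR-51-2), file 2 of 2: the decorated record `HistReadDataLWD`
(custodian, p294821) and the key-side record `HistReadDataLWK` (leaf-02, p297996 — THE NEWEST) on M5-2e's ledger through file
1's `HistReadDataLW.toLP82`, their window-EXPLICIT L-witnesses at `ellVolS82`, and SECOND PROOFS of their (window-blind) terminal theorems of record.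
Released under the licence of the surrounding project. -/
import Summits.QuantumFields.BalabanUV.T4Continuum.Support.HistoryRealiseCellsRunAssemblyWTVSLWP82
import Summits.QuantumFields.BalabanUV.T4Continuum.Support.HistoryRealiseCellsRunAssemblyWTVSLWK

/-!
# D-50-2 «THE SHRUNK RECORD» DELIVERED AS AN EMBEDDING, file 2: THE DECORATED AND THE KEY-SIDE RECORDS ON M5-2e's LEDGER —
# window-explicit L-witnesses at `ellVolS82` and second proofs of `…LWD_fsc` ∕ `…LWK_fsc` (weight `cvol82`)
# (D-50-2′ part 5, IR-51-2; re-open object (α) of row NE7b; custodian lineage `t4-ne7b-formalise-leaf-03` gen 28)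

Summits-side support leaf of the T⁴-continuum cell (rung (B)+1 on a FINITE torus only; NOT infinite volume, NOT the
mass gap, NOT the Clay statement; NOT a proof of the spine estimate NE7b — the cell's OWN estimate, NOT PRINTED, NOT
PROVED).  [folklore] composition BY NAME, two theorems and two `example`s, no `def`: `HistReadDataLWD.toLW` (custodian, p295979) and
`HistReadDataLWK.toLWD` (leaf-02, p298331) followed by file 1's `HistReadDataLW.toLP82` and part 4's assembly ∕ terminal theorem
over the plug record.  No `[cite:]` tag, nothing printed asserted, no `Prop` fact minted, zero `sorry`.  NO record is
twinned (120 ∕ 131 fields consumed as they are).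

WHY ∕ WHAT.  As file 1, for the two records downstream of the prefix: §1 the L-witnesses
**`nonempty_countRoadWitnessT3bWTVSL_of_histReadingLWD82`** ∕ **`…LWK82`** (NEW statements: the parents' with the ONE hunk `ellVol …
(jvol …) ↦ ellVolS82 … (jvol82 …)` in `hIv`); §2 two `example`s `type_of% (continuumYM4Torus_of_histReadingLWD_fsc …)` ∕
`type_of% (…LWK_fsc …)` proved by the LP road at the volume threshold `e^{−ℓᵥ82∕2}` — the terminal theorems of record
(p295979 ∕ p298331; the key-side one = the (α) terminal theorem on the NEWEST record, W-ne7bp1-g51-2) are WINDOW-BLIND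
(located by leaf-02 g32, P-ne7bleaf02-g32-1: `ForSmallCouplings` absorbs any positive threshold via
`forSmallCouplings_mono_inInterval₂`), so M5-2e gives them a second PROOF, not a new TYPE.

BY-NAME EFFECT (`WALL-NE7b-P1.md` §2, G-M5-2; the owner's W-ne7bp1-g51-5 (d), as corrected by P-ne7bleaf02-g32-1): the terminal
theorems are UNCHANGED by name and by type; they now ALSO hold through M5-2e's ledger, whose window lemma is §1's; rows «volume calibrations» ∕ (WS1⁸²) ∕ `RoundingRoomF` unchanged in CLASS (K modulo PREFIX + C-side); census sentence
(VOLUME-4's `361.46·ρ`; NIL iff ρ ≤ 1.2067 … 1.5632 under reading (A) — thin, refuter v20∕v21) = a sentence about §1's window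
lemmas ∕ the size of the implicit small coupling, NOT about the terminal statements.  HONEST
SCOPE.  CONDITIONAL on everything the records display; ρ UNVALUED; nothing of Bałaban's asserted, instantiated or discharged;
NE7b NOT proved; spine 0∕9.  HONEST DEPENDENCY (cell): continuum YM on T⁴ ⇐ BetaPertH ∧ nine spine estimates (0/9 proved);
BetaPertH ⇐ (D1) ∧ (D4) ∧ CAP+tail; G-an2-4 gates asym, D1 and NE2/3/4.  This file changes none of it.
-/
open Finset MeasureTheory
open Literature.MathematicalPhysics.QuantumFieldTheory.Balaban1983to89
open T4PersistenceDictionary T4PersistentHistoryCount T4BankedInduction T4PrintedShapeBanking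
open T4WeightBudget T4GlobalDenominator T4LiveClassFibration T4LiveStructureGas T4LiveGasToTerms T4RecordPriceSeam
open T4PartnerMultiplicity T4IndicatorShell T4MatchingAssembly T4MatchingClosure T4MatchingClosureSocket T4Continuum
open T4StabilitySocket T4BranchingRecordsGas T4TaggedShapeBanking T4CanonicalMenus T4RenewalChains
open Summit.QuantumFields.BalabanUV.T4Continuum.PlacementBatch Summit.QuantumFields.BalabanUV.T4Continuum.PlacementSkeleton
open Summit.QuantumFields.BalabanUV.T4Continuum.CountThresholdUniform Summit.QuantumFields.BalabanUV.T4Continuum.CountThresholdExit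
open Summit.QuantumFields.BalabanUV.T4Continuum.CountSeamJunction Summit.QuantumFields.BalabanUV.T4Continuum.LateMergers
open Summit.QuantumFields.BalabanUV.T4Continuum.HistoryFlow Summit.QuantumFields.BalabanUV.T4Continuum.HistoryRegeneration
open Summit.QuantumFields.BalabanUV.T4Continuum.HistoryTables Summit.QuantumFields.BalabanUV.T4Continuum.HistoryAssemblyTrees
open Summit.QuantumFields.BalabanUV.T4Continuum.HistoryAssemblyTerms Summit.QuantumFields.BalabanUV.T4Continuum.HistoryAssemblyPedigree
open Summit.QuantumFields.BalabanUV.T4Continuum.HistoryConstants Summit.QuantumFields.BalabanUV.T4Continuum.HistoryGen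
open Literature.MathematicalPhysics.QuantumFieldTheory.Balaban1983to89.B13ScaleTransfer
open Summit.QuantumFields.BalabanUV.T4Continuum.ZoneSkeleton Summit.QuantumFields.BalabanUV.T4Continuum.HistorySocketTH
open Summit.QuantumFields.BalabanUV.T4Continuum.HistoryCaps Summit.QuantumFields.BalabanUV.T4Continuum.HistoryAssemblyPrice
open Summit.QuantumFields.BalabanUV.T4Continuum.HistoryBankingLE Summit.QuantumFields.BalabanUV.T4Continuum.HistoryExitLE
open Summit.QuantumFields.BalabanUV.T4Continuum.HistoryAssemblyTreesLE Summit.QuantumFields.BalabanUV.T4Continuum.HistoryAssemblyTermsLE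
open Summit.QuantumFields.BalabanUV.T4Continuum.HistoryRealise Summit.QuantumFields.BalabanUV.T4Continuum.HistoryAssemblyRealiseLE
open Summit.QuantumFields.BalabanUV.T4Continuum.HistoryAssemblyMult Summit.QuantumFields.BalabanUV.T4Continuum.HistoryAssemblyMultKey
open Summit.QuantumFields.BalabanUV.T4Continuum.HistoryAssemblyRealiseRun Summit.QuantumFields.BalabanUV.T4Continuum.HistoryAssemblyRealiseMult
open Summit.QuantumFields.BalabanUV.T4Continuum.HistoryZones Summit.QuantumFields.BalabanUV.T4Continuum.HistoryRealiseCells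
open Summit.QuantumFields.BalabanUV.T4Continuum.HistoryRealiseCellsRun Summit.QuantumFields.BalabanUV.T4Continuum.HistoryAssemblyRealiseRunMult
open Summit.QuantumFields.BalabanUV.T4Continuum.HistoryRealiseCellsRunMult Summit.QuantumFields.BalabanUV.T4Continuum.HistoryAssemblyMultInstance
open Summit.QuantumFields.BalabanUV.T4Continuum.HistoryJoinsPlacedMember Summit.QuantumFields.BalabanUV.T4Continuum.PlacementSkeleton
open Summit.QuantumFields.BalabanUV.T4Continuum.HistoryJoinsPlacedMult Summit.QuantumFields.BalabanUV.T4Continuum.HistoryRealiseDistinct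
open Summit.QuantumFields.BalabanUV.T4Continuum.HistoryRegionTemplates Summit.QuantumFields.BalabanUV.T4Continuum.HistoryCaps
open Summit.QuantumFields.BalabanUV.T4Continuum.HistoryZoneEvolve (cth)
open Literature.MathematicalPhysics.QuantumFieldTheory.Balaban1983to89.B16SProfile (DropCtl)
open Summit.QuantumFields.BalabanUV.T4Continuum.HistoryRealiseCellsRunMultEnd Summit.QuantumFields.BalabanUV.T4Continuum.HistoryRealiseCellsRunMultEndD
open Summit.QuantumFields.BalabanUV.T4Continuum.HistoryRealiseCellsRunPinnedT3b Summit.QuantumFields.BalabanUV.T4Continuum.HistoryHybridRescale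
open Summit.QuantumFields.BalabanUV.T4Continuum.HistoryRealiseCellsRunApex (exists_const_schemeZ)
open Summit.QuantumFields.BalabanUV.T4Continuum.HistoryRealisePrint Summit.QuantumFields.BalabanUV.T4Continuum.HistoryRealiseWeak
open Summit.QuantumFields.BalabanUV.T4Continuum.HistoryRealisePrintReading Summit.QuantumFields.BalabanUV.T4Continuum.HistoryRealiseWeakReading
open Summit.QuantumFields.BalabanUV.T4Continuum.HistoryRealisePrintCells Summit.QuantumFields.BalabanUV.T4Continuum.HistoryRealiseWeakCells
open Summit.QuantumFields.BalabanUV.T4Continuum.HistoryRealiseCellsRunApexT3b Summit.QuantumFields.BalabanUV.T4Continuum.HistoryRealiseCellsRunApexT3bW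

open Summit.QuantumFields.BalabanUV.T4Continuum.HistoryRealiseCellsRunApexT3bWT Summit.QuantumFields.BalabanUV.T4Continuum.HistoryRealiseCellsRunPinnedT3bWT
open Summit.QuantumFields.BalabanUV.T4Continuum.HistoryRealiseCellsRunHeadlineT3bWT
open Summit.QuantumFields.BalabanUV.T4Continuum.HistoryRealiseCellsRunApexT3bWTV Summit.QuantumFields.BalabanUV.T4Continuum.HistoryBankingVolumePlug
open Summit.QuantumFields.BalabanUV.T4Continuum.HistoryRealiseCellsRunApexT3bWTVS
open Summit.QuantumFields.BalabanUV.T4Continuum.HistoryGenealogyRealise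
open Summit.QuantumFields.BalabanUV.T4Continuum.HistoryGenealogyInstantiate
open Summit.QuantumFields.BalabanUV.T4Continuum.B16HistoryIndexedRepr
open Summit.QuantumFields.BalabanUV.T4Continuum.B16HistoryIndexedTrunc
open Summit.QuantumFields.BalabanUV.T4Continuum.HistoryBankingDiscountCharge
open Summit.QuantumFields.BalabanUV.T4Continuum.HistoryBankingCreditRead
open Summit.QuantumFields.BalabanUV.T4Continuum.HistoryBankingFibreRoom
open Summit.QuantumFields.BalabanUV.T4Continuum.HistoryPriceKeys
open Summit.QuantumFields.BalabanUV.T4Continuum.HistoryRealiseCellsRunSupplyWTVS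
open Summit.QuantumFields.BalabanUV.T4Continuum.HistoryRealiseCellsRunSupplyKeysWTVS

open Summit.QuantumFields.BalabanUV.T4Continuum.HistoryRealiseCellsRunAssemblyWTVSData
open Summit.QuantumFields.BalabanUV.T4Continuum.HistoryRealiseCellsRunAssemblyWTVSDataL
open Summit.QuantumFields.BalabanUV.T4Continuum.HistoryRealiseCellsRunAssemblyWTVSDataLW
open Summit.QuantumFields.BalabanUV.T4Continuum.HistoryRealiseCellsRunAssemblyWTVSL
open Summit.QuantumFields.BalabanUV.T4Continuum.HistoryRealiseCellsRunApexT3bWTVSL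
open Summit.QuantumFields.BalabanUV.T4Continuum.HistoryBankingSharpShares (sBsharp)
open Summit.QuantumFields.BalabanUV.T4Continuum.HistoryBankingRoundingSupply (ellStar)
open Summit.QuantumFields.BalabanUV.T4Continuum.HistoryBankingRoundingUnrounded (sRunr ApFlat)
open Summit.QuantumFields.BalabanUV.T4Continuum.HistoryBankingRoundingTuned
open Summit.QuantumFields.BalabanUV.T4Continuum.HistoryBankingVolumeWindow
open Summit.QuantumFields.BalabanUV.T4Continuum.HistoryBankingVolumeSupply

open Summit.QuantumFields.BalabanUV.T4Continuum.HistoryBankingAnchors82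
open Summit.QuantumFields.BalabanUV.T4Continuum.HistoryBankingShrunkLedger82
open Summit.QuantumFields.BalabanUV.T4Continuum.HistoryBankingVolumeWindowCollar
open Summit.QuantumFields.BalabanUV.T4Continuum.HistoryBankingVolumeWindowShrunk82
open Summit.QuantumFields.BalabanUV.T4Continuum.HistoryRealiseCellsRunAssemblyWTVSDataLW
open Summit.QuantumFields.BalabanUV.T4Continuum.HistoryRealiseCellsRunAssemblyWTVSDataLWD
open Summit.QuantumFields.BalabanUV.T4Continuum.HistoryRealiseCellsRunAssemblyWTVSDataLWK
open Summit.QuantumFields.BalabanUV.T4Continuum.HistoryRealiseCellsRunAssemblyWTVSDataLP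
open Summit.QuantumFields.BalabanUV.T4Continuum.HistoryRealiseCellsRunAssemblyWTVSLW
open Summit.QuantumFields.BalabanUV.T4Continuum.HistoryRealiseCellsRunAssemblyWTVSLWD
open Summit.QuantumFields.BalabanUV.T4Continuum.HistoryRealiseCellsRunAssemblyWTVSLWK
open Summit.QuantumFields.BalabanUV.T4Continuum.HistoryRealiseCellsRunAssemblyWTVSLP
open Summit.QuantumFields.BalabanUV.T4Continuum.HistoryRealiseCellsRunAssemblyWTVSLWP82

namespace Summit.QuantumFields.BalabanUV.T4Continuum.HistoryRealiseCellsRunAssemblyWTVSLWKP82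

noncomputable section

set_option synthInstance.maxSize 1024

/-! ## §1 The L-witnesses on M5-2e's ledger from the decorated and the key-side records -/

section Assembly

variable {F : T4Family} {G : Type*} [GaugeGroup G] [MeasurableSpace G] [HaarData G] [RegularGaugeGroup G]
  {D : FiniteEpsData F G} {C : T4PrintedShapeBanking.Consts} {O : PrintedO1s} {θv : ℝ} {rr d n : ℕ} {hn : 0 < n}
  {g₀ : ℕ → ℝ} {os : List (ULoop F)} {cΛ Lr Φ β₀ : ℝ} {p₁ η η' κ κ₂ κᵥ : ℕ} {DomK : ℕ → Type}
  {I : (K : ℕ) → HIndex (DomK K)} [DecidableEq (HIndex.Idx I)] {DomK' : ℕ → Type} {I' : (K : ℕ) → HIndex (DomK' K)}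
  {Xs : ℕ → Type} [∀ K, MeasurableSpace (Xs K)] {μ : (K : ℕ) → Measure (Xs K)} [∀ K, IsFiniteMeasure (μ K)]
  {𝒢 : (K : ℕ) → GoodClass (Xs K)} {Y : ℕ → Type} [∀ K, MeasurableSpace (Y K)] {νB : (K : ℕ) → Measure (Y K)}
  [∀ K, IsFiniteMeasure (νB K)] {𝒢' : (K : ℕ) → GoodClass (Y K)}

omit [RegularGaugeGroup G] in
/-- **THE L-WITNESS FROM A DECORATED RECORD ON M5-2e's LEDGER** (`HistReadDataLWD`, p294821: `toLW` ∘ file 1's `toLP82` ∘ part 4 §1). [folklore] -/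
theorem nonempty_countRoadWitnessT3bWTVSL_of_histReadingLWD82 {Dc Sl : Type}
    (Dd : HistReadDataLWD D C O θv rr d n hn g₀ os cΛ Lr Φ β₀ p₁ η η' κ κ₂ κᵥ Dc Sl I I' Xs μ 𝒢 Y νB 𝒢')
    (hIr : ∀ K, (D.C ⟨K, F.m, g₀ K⟩).flow.InInterval
      (Real.exp (-(ellStar C O F.L (O.d + 3) η η' κ (ApFlat O.γ₀ O.A₁ O.M Lr O.d) Φ / 2))) K)
    (hIv : ∀ K, (D.C ⟨K, F.m, g₀ K⟩).flow.InInterval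
      (Real.exp (-(ellVolS82 C d κ₂ κᵥ cΛ θv (1 + β₀) (jvol82 d (1 + β₀)) / 2))) K) :
    Nonempty (CountRoadWitnessT3bWTVSL D C O θv rr d n hn g₀ os (HIndex.Idx I) (ℕ × Lab d) (Lab d)) :=
  nonempty_countRoadWitnessT3bWTVSL_of_histReadingLP (Dd.toLW.toLP82 hIr hIv)

omit [RegularGaugeGroup G] in
/-- **… AND FROM A KEY-SIDE RECORD** (the NEWEST record `HistReadDataLWK`, p297996∕p298331: `toLWD` ∘ `toLW` ∘ file 1's `toLP82` ∘ part 4 §1). [folklore] -/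
theorem nonempty_countRoadWitnessT3bWTVSL_of_histReadingLWK82 {β : Type} [DecidableEq β]
    (Dd : HistReadDataLWK D C O θv rr d n hn g₀ os cΛ Lr Φ β₀ p₁ η η' κ κ₂ κᵥ β I I' Xs μ 𝒢 Y νB 𝒢')
    (hIr : ∀ K, (D.C ⟨K, F.m, g₀ K⟩).flow.InInterval
      (Real.exp (-(ellStar C O F.L (O.d + 3) η η' κ (ApFlat O.γ₀ O.A₁ O.M Lr O.d) Φ / 2))) K)
    (hIv : ∀ K, (D.C ⟨K, F.m, g₀ K⟩).flow.InInterval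
      (Real.exp (-(ellVolS82 C d κ₂ κᵥ cΛ θv (1 + β₀) (jvol82 d (1 + β₀)) / 2))) K) :
    Nonempty (CountRoadWitnessT3bWTVSL D C O θv rr d n hn g₀ os (HIndex.Idx I) (ℕ × Lab d) (Lab d)) :=
  nonempty_countRoadWitnessT3bWTVSL_of_histReadingLP (Dd.toLWD.toLW.toLP82 hIr hIv)

end Assembly

/-! ## §2 The terminal theorems of record, proved a second time through the per-level dead-box ledger -/

section SU

variable {F : T4Family} {N : ℕ} [NeZero N] {ℰ : LoopAverage (Matrix.specialUnitaryGroup (Fin N) ℂ)}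

/-- **THE DECORATED RECORD's TERMINAL THEOREM OF RECORD HAS A SECOND PROOF THROUGH M5-2e's LEDGER** (conservativity
certificate; an `example` — the statement of `HistoryRealiseCellsRunAssemblyWTVSLWD.continuumYM4Torus_of_histReadingLWD_fsc` (p295979) is
window-blind, P-ne7bleaf02-g32-1, so it is not re-declared): the LP road ∘ `toLW` ∘ file 1's `toLP82` at the volume threshold
`e^{−ℓᵥ82∕2}` is accepted AT ITS TYPE, read off by `type_of%`. [folklore] -/
example (D : FiniteEpsData F (Matrix.specialUnitaryGroup (Fin N) ℂ))
    (hBA : D.IsBlockAveraged ℰ) (hE : ℰ.MeasurableE)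
    (hB : B16.EndStatementBPrinted D.C) (hβ : BetaPertHyp D.βfun) (hsign : B16.SignConventions D.C)
    {C : T4PrintedShapeBanking.Consts} {O : PrintedO1s}
    {rr : ℕ} {β₀ : ℝ} (h : ThresholdOK C F.L rr β₀) (hμ : 0 < C.μ) (d n : ℕ)
    (hκ₁ : (d : ℝ) * Real.log F.L + 2 * Real.log 2 ≤ C.κ₁) (hE₀ : Real.log (2 + birthMass C) ≤ C.E₀)
    (hA₀ : 1 ≤ C.A₀) (hβ₀ : 0 < β₀) (hLβ : (F.L : ℝ) * β₀ ≤ 1) (hn₁ : 13 ≤ C.n₁) (hn : 0 < n)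
    {θ θv : ℝ} (hθ : 0 < θ) (hslack : C.a + (θ + θv) ≤ O.γ₀ * O.A₁ ^ 2 / 2)
    (hE₂ : 0 < C.E₂) (hE₃ : 0 ≤ C.E₃) {sS : ℕ} (hsS : 1 ≤ sS)
    (hsmall : (((2 * cth 32 1 sS + 1) ^ d : ℕ) : ℝ) * (5 : ℝ) ^ d * ((max 1 (2 * 32 + 2) : ℕ) : ℝ) ≤
      (F.L : ℝ) ^ (sS / 2) / 2)
    {θc : ℝ} (hθc0 : 0 ≤ θc) (hθc1 : θc < 1) (hθcs : 1 / 2 ≤ θc ^ sS)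
    {cΛ Lr Φ b₀ : ℝ} {p₁ η η' κ κ₂ κᵥ : ℕ}
    (hRead : T4ContinuumYM4Torus.ForSmallCouplings D fun g₀ => ∀ os : List (ULoop F),
        ∃ (DomK : ℕ → Type) (I : (K : ℕ) → HIndex (DomK K)) (_ : DecidableEq (HIndex.Idx I)) (DomK' : ℕ → Type)
          (I' : (K : ℕ) → HIndex (DomK' K)) (X : ℕ → Type) (_ : ∀ K, MeasurableSpace (X K))
          (μ : (K : ℕ) → Measure (X K)) (_ : ∀ K, IsFiniteMeasure (μ K)) (𝒢 : (K : ℕ) → GoodClass (X K))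
          (Y : ℕ → Type) (_ : ∀ K, MeasurableSpace (Y K)) (νB : (K : ℕ) → Measure (Y K))
          (_ : ∀ K, IsFiniteMeasure (νB K)) (𝒢' : (K : ℕ) → GoodClass (Y K)) (Dc Sl : Type),
          Nonempty (HistReadDataLWD D C O θv rr d n hn g₀ os cΛ Lr Φ b₀ p₁ η η' κ κ₂ κᵥ Dc Sl I I' X μ 𝒢 Y νB 𝒢')) :
    type_of% (continuumYM4Torus_of_histReadingLWD_fsc D hBA hE hB hβ hsign h hμ d n hκ₁ hE₀ hA₀ hβ₀ hLβ hn₁ hn hθ hslack hE₂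
      hE₃ hsS hsmall hθc0 hθc1 hθcs hRead) :=
  continuumYM4Torus_of_histReadingLP_fsc D hBA hE hB hβ hsign h hμ d n hκ₁ hE₀ hA₀ hβ₀ hLβ hn₁ hn hθ hslack hE₂ hE₃ hsS
    hsmall hθc0 hθc1 hθcs
    (forSmallCouplings_mono_inInterval₂ D
      (Real.exp_pos (-(ellStar C O F.L (O.d + 3) η η' κ (ApFlat O.γ₀ O.A₁ O.M Lr O.d) Φ / 2)))
      (Real.exp_pos (-(ellVolS82 C d κ₂ κᵥ cΛ θv (1 + b₀) (jvol82 d (1 + b₀)) / 2)))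
      (fun g₀ hIr hIv hg os => by
        obtain ⟨DomK, I, iI, DomK', I', X, mX, μ, hμf, 𝒢, Y, mY, νB, hνf, 𝒢', Dc, Sl, ⟨Dd⟩⟩ := hg os
        exact ⟨DomK, I, iI, DomK', I', X, mX, μ, hμf, 𝒢, Y, mY, νB, hνf, 𝒢', ⟨Dd.toLW.toLP82 hIr hIv⟩⟩)
      hRead)


/-- **THE NEWEST RECORD's TERMINAL THEOREM OF RECORD HAS A SECOND PROOF THROUGH M5-2e's LEDGER** (W-ne7bp1-g51-2 «base it on
the NEWEST record»; conservativity certificate; an `example` — the statement of leaf-02's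
`HistoryRealiseCellsRunAssemblyWTVSLWK.continuumYM4Torus_of_histReadingLWK_fsc` (p298331) is window-blind, P-ne7bleaf02-g32-1): the LP road ∘
`toLWD` ∘ `toLW` ∘ `toLP82` at `e^{−ℓᵥ82∕2}` is accepted AT ITS TYPE.  CONDITIONAL on everything the record displays —
`HistRead`, the pass-V inputs, `hF` at `S_h`, `hΛ`, the key-side (ρ0)–(ρ3) items, (γ), NE7c∕NE7 sockets, (B), `BetaPertHyp`;
NE7b NOT proved; count 0∕9. [folklore] -/
example (D : FiniteEpsData F (Matrix.specialUnitaryGroup (Fin N) ℂ))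
    (hBA : D.IsBlockAveraged ℰ) (hE : ℰ.MeasurableE)
    (hB : B16.EndStatementBPrinted D.C) (hβ : BetaPertHyp D.βfun) (hsign : B16.SignConventions D.C)
    {C : T4PrintedShapeBanking.Consts} {O : PrintedO1s}
    {rr : ℕ} {β₀ : ℝ} (h : ThresholdOK C F.L rr β₀) (hμ : 0 < C.μ) (d n : ℕ)
    (hκ₁ : (d : ℝ) * Real.log F.L + 2 * Real.log 2 ≤ C.κ₁) (hE₀ : Real.log (2 + birthMass C) ≤ C.E₀)
    (hA₀ : 1 ≤ C.A₀) (hβ₀ : 0 < β₀) (hLβ : (F.L : ℝ) * β₀ ≤ 1) (hn₁ : 13 ≤ C.n₁) (hn : 0 < n)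
    {θ θv : ℝ} (hθ : 0 < θ) (hslack : C.a + (θ + θv) ≤ O.γ₀ * O.A₁ ^ 2 / 2)
    (hE₂ : 0 < C.E₂) (hE₃ : 0 ≤ C.E₃) {sS : ℕ} (hsS : 1 ≤ sS)
    (hsmall : (((2 * cth 32 1 sS + 1) ^ d : ℕ) : ℝ) * (5 : ℝ) ^ d * ((max 1 (2 * 32 + 2) : ℕ) : ℝ) ≤
      (F.L : ℝ) ^ (sS / 2) / 2)
    {θc : ℝ} (hθc0 : 0 ≤ θc) (hθc1 : θc < 1) (hθcs : 1 / 2 ≤ θc ^ sS)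
    {cΛ Lr Φ b₀ : ℝ} {p₁ η η' κ κ₂ κᵥ : ℕ}
    (hRead : T4ContinuumYM4Torus.ForSmallCouplings D fun g₀ => ∀ os : List (ULoop F),
        ∃ (DomK : ℕ → Type) (I : (K : ℕ) → HIndex (DomK K)) (_ : DecidableEq (HIndex.Idx I)) (DomK' : ℕ → Type)
          (I' : (K : ℕ) → HIndex (DomK' K)) (X : ℕ → Type) (_ : ∀ K, MeasurableSpace (X K))
          (μ : (K : ℕ) → Measure (X K)) (_ : ∀ K, IsFiniteMeasure (μ K)) (𝒢 : (K : ℕ) → GoodClass (X K))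
          (Y : ℕ → Type) (_ : ∀ K, MeasurableSpace (Y K)) (νB : (K : ℕ) → Measure (Y K))
          (_ : ∀ K, IsFiniteMeasure (νB K)) (𝒢' : (K : ℕ) → GoodClass (Y K)) (β : Type) (_ : DecidableEq β),
          Nonempty (HistReadDataLWK D C O θv rr d n hn g₀ os cΛ Lr Φ b₀ p₁ η η' κ κ₂ κᵥ β I I' X μ 𝒢 Y νB 𝒢')) :
    type_of% (continuumYM4Torus_of_histReadingLWK_fsc D hBA hE hB hβ hsign h hμ d n hκ₁ hE₀ hA₀ hβ₀ hLβ hn₁ hn hθ hslack hE₂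
      hE₃ hsS hsmall hθc0 hθc1 hθcs hRead) :=
  continuumYM4Torus_of_histReadingLP_fsc D hBA hE hB hβ hsign h hμ d n hκ₁ hE₀ hA₀ hβ₀ hLβ hn₁ hn hθ hslack hE₂ hE₃ hsS
    hsmall hθc0 hθc1 hθcs
    (forSmallCouplings_mono_inInterval₂ D
      (Real.exp_pos (-(ellStar C O F.L (O.d + 3) η η' κ (ApFlat O.γ₀ O.A₁ O.M Lr O.d) Φ / 2)))
      (Real.exp_pos (-(ellVolS82 C d κ₂ κᵥ cΛ θv (1 + b₀) (jvol82 d (1 + b₀)) / 2)))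
      (fun g₀ hIr hIv hg os => by
        obtain ⟨DomK, I, iI, DomK', I', X, mX, μ, hμf, 𝒢, Y, mY, νB, hνf, 𝒢', β, iβ, ⟨Dd⟩⟩ := hg os
        exact ⟨DomK, I, iI, DomK', I', X, mX, μ, hμf, 𝒢, Y, mY, νB, hνf, 𝒢', ⟨Dd.toLWD.toLW.toLP82 hIr hIv⟩⟩)
      hRead)

end SU

end

end Summit.QuantumFields.BalabanUV.T4Continuum.HistoryRealiseCellsRunAssemblyWTVSLWKP82
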